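import Summits.Schanuel.Schanuel.Theorems.ZilberEacExpExpBalanceLemmas
import Literature.ModelTheory.Zilber.EACDensityAligned
import Mathlib.Analysis.Calculus.Deriv.Polynomial
import Mathlib.Analysis.Calculus.MeanValue
import HarnessLib

/-!
# The exponential–exponential balance over graph bases of every degree: lemmas

Zilber's Exponential-Algebraic Closedness, case ladder (host summit Schanuel, cell `pub-schanuel`,
seat 2, gen 8).  Lemmas for `ZilberEacExpExpBalanceGeneral`, which solves
`e^{z} = A(z) + e^{p(z)} F(e^{p(z)})` for EVERY `p ∈ ℂ[x]` of degree `D ≥ 3` (the quadratic case is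
`ZilberEacExpExpBalance`) by balancing the two exponentials near a root `z_k` of
`e p(z) - z = log lc(F) + 2πik` and linearising in the local coordinate `z = z_k + λ_k t`,
`λ_k = 1/(1 - e p'(z_k))` — no inverse branch of `p` is needed.  Here:

* `exists_root_near` — if `‖Q(w)‖ < |lc Q| δ^{deg Q}` then `Q` has a root within `δ` of `w`
  (`Q = lc ∏ (X - r)` over `ℂ`);
* `half_norm_le_re_cpow_inv` — for `D ≥ 3` the principal `D`-th root of any `W` has
  `Re W^{1/D} ≥ ‖W^{1/D}‖/2` (its argument lies in `[-π/3, π/3]`);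
* `norm_eval_add_sub_sub_le` — the quadratic Taylor remainder
  `‖p(a+s) - p(a) - p'(a)s‖ ≤ B_{p'} (D-1) M^{D-2} ‖s‖²` (`‖a‖ + ‖s‖ ≤ M`, mean value inequality);
* `expExp_perturbation_bound_of_norm_le` — the pointwise bound of `ZilberEacExpExpBalanceLemmas`
  with `‖ζ‖ ≤ R` in place of `‖ζ‖ < 1`;
* `norm_exp_mul_one_add_sub_one_le` — `‖e^{h}(1+g) - 1‖ ≤ 1/32` for `‖h‖, ‖g‖ ≤ 1/200`.

HONEST FRAMING: auxiliary analysis; nothing here bears on Schanuel's conjecture; EAC ⇏ SC.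
-/

noncomputable section

open Complex Filter Topology Metric
open Literature.ModelTheory.Zilber

set_option linter.dupNamespace false

namespace Summit.Schanuel.Schanuel.Theorems

/-- **A root near a point of small value.**  If `‖Q(w)‖ < ‖lc Q‖ δ^{deg Q}` (`δ > 0`) then `Q`
has a root `z` with `‖z - w‖ < δ`: over `ℂ`, `Q(w) = lc Q · ∏_{roots r} (w - r)`. [folklore] -/
theorem exists_root_near (Q : Polynomial ℂ) (w : ℂ) {δ : ℝ} (hδ : 0 < δ)
    (h : ‖Q.eval w‖ < ‖Q.leadingCoeff‖ * δ ^ Q.natDegree) :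
    ∃ z : ℂ, Q.eval z = 0 ∧ ‖z - w‖ < δ := by
  classical
  by_contra hne
  push Not at hne
  have hsplit : Q.Splits := IsAlgClosed.splits Q
  have heval := hsplit.eval_eq_prod_roots w
  have hcard := hsplit.natDegree_eq_card_roots
  -- every root is at distance `≥ δ` from `w`
  have hfar : ∀ a ∈ Q.roots, δ ≤ ‖w - a‖ := by
    intro a ha
    have hQ0 : Q ≠ 0 := Polynomial.ne_zero_of_mem_roots ha
    have hroot : Q.eval a = 0 := (Polynomial.mem_roots hQ0).1 ha
    rw [norm_sub_rev]
    exact hne a hroot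
  have key : ∀ s : Multiset ℂ, (∀ a ∈ s, δ ≤ ‖w - a‖) →
      δ ^ Multiset.card s ≤ ‖(s.map (w - ·)).prod‖ := by
    intro s
    induction s using Multiset.induction_on with
    | empty => intro; simp
    | cons a s ih =>
        intro hs
        rw [Multiset.map_cons, Multiset.prod_cons, Multiset.card_cons, pow_succ, norm_mul, mul_comm]
        exact mul_le_mul (hs a (Multiset.mem_cons_self a s))
          (ih fun b hb => hs b (Multiset.mem_cons_of_mem hb)) (by positivity) (norm_nonneg _)
  have hge : ‖Q.leadingCoeff‖ * δ ^ Q.natDegree ≤ ‖Q.eval w‖ := by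
    rw [heval, norm_mul, hcard]
    exact mul_le_mul_of_nonneg_left (key _ hfar) (norm_nonneg _)
  exact absurd h (not_lt.2 hge)

/-- **The principal `D`-th root points to the right** (`D ≥ 3`): `Re W^{1/D} ≥ ‖W^{1/D}‖ / 2`,
since `arg W / D ∈ [-π/3, π/3]` and `cos ≥ 1/2` there. [folklore] -/
theorem half_norm_le_re_cpow_inv {D : ℕ} (hD : 3 ≤ D) (W : ℂ) :
    ‖W ^ ((D : ℂ)⁻¹)‖ / 2 ≤ (W ^ ((D : ℂ)⁻¹)).re := by
  have hD0 : (D : ℂ) ≠ 0 := by exact_mod_cast (show D ≠ 0 by omega)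
  have hDinv : ((D : ℂ)⁻¹) ≠ 0 := inv_ne_zero hD0
  by_cases hW : W = 0
  · rw [hW, Complex.zero_cpow hDinv]; simp
  rw [Complex.cpow_def_of_ne_zero hW, Complex.norm_exp, Complex.exp_re]
  have hDpos : (0 : ℝ) < D := by exact_mod_cast (show 0 < D by omega)
  have hD3 : (3 : ℝ) ≤ D := by exact_mod_cast hD
  have hinv : (D : ℂ)⁻¹ = ((D⁻¹ : ℝ) : ℂ) := by push_cast; rfl
  have him : (Complex.log W * (D : ℂ)⁻¹).im = Complex.arg W / D := by
    rw [hinv, Complex.mul_im, Complex.ofReal_re, Complex.ofReal_im, mul_zero, zero_add,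
      Complex.log_im]
    ring
  rw [him]
  have harg1 : Complex.arg W ≤ Real.pi := Complex.arg_le_pi W
  have harg2 : -Real.pi < Complex.arg W := Complex.neg_pi_lt_arg W
  have hcos : 1 / 2 ≤ Real.cos (Complex.arg W / D) := by
    rw [← Real.cos_abs, ← Real.cos_pi_div_three]
    apply Real.cos_le_cos_of_nonneg_of_le_pi (abs_nonneg _)
      (by linarith [Real.pi_pos])
    rw [abs_div, abs_of_pos hDpos, div_le_div_iff₀ hDpos (by norm_num : (0:ℝ) < 3)]
    have : |Complex.arg W| ≤ Real.pi := abs_le.2 ⟨harg2.le, harg1⟩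
    nlinarith [Real.pi_pos]
  have hE := Real.exp_pos (Complex.log W * (D : ℂ)⁻¹).re
  rw [div_le_iff₀ (by norm_num : (0:ℝ) < 2)]
  nlinarith

/-- **Quadratic Taylor remainder for polynomials**: for `‖a‖ + ‖s‖ ≤ M`, `1 ≤ M`,
`‖p(a + s) - p(a) - p'(a) s‖ ≤ B_{p'} · (D - 1) · M^{D-2} · ‖s‖²` (`D - 1`, `D - 2` in `ℕ`,
`D = deg p`, `B_{p'}` the coefficient-norm sum of `p'`), by the mean value inequality applied to
`x ↦ p(x) - p'(a) x` on the disc `‖x - a‖ ≤ ‖s‖` and the Lipschitz bound for `p'`. [folklore] -/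
theorem norm_eval_add_sub_sub_le (p : Polynomial ℂ) {a s : ℂ} {M : ℝ} (hM : 1 ≤ M)
    (has : ‖a‖ + ‖s‖ ≤ M) :
    ‖p.eval (a + s) - p.eval a - p.derivative.eval a * s‖ ≤
      coeffNormSum p.derivative * ((p.natDegree - 2 : ℕ) + 1) * M ^ (p.natDegree - 2) * ‖s‖ *
        ‖s‖ := by
  set L : ℝ := coeffNormSum p.derivative * ((p.natDegree - 2 : ℕ) + 1) * M ^ (p.natDegree - 2) *
    ‖s‖ with hL
  set f : ℂ → ℂ := fun x => p.eval x - p.derivative.eval a * x with hf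
  have hdiff : ∀ x ∈ closedBall a ‖s‖, DifferentiableAt ℂ f x := fun x _ =>
    (p.differentiableAt).sub ((differentiableAt_const _).mul differentiableAt_id)
  have hderiv : ∀ x, deriv f x = p.derivative.eval x - p.derivative.eval a := by
    intro x
    have h := (p.hasDerivAt x).sub ((hasDerivAt_id' x).const_mul (p.derivative.eval a))
    rw [mul_one] at h
    exact h.deriv
  have ha : ‖a‖ ≤ M := by linarith [norm_nonneg s]
  have hbound : ∀ x ∈ closedBall a ‖s‖, ‖deriv f x‖ ≤ L := by
    intro x hx
    rw [mem_closedBall, dist_eq_norm] at hx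
    have hxM : ‖x‖ ≤ M := by
      have := norm_le_norm_add_norm_sub' x a
      have h2 : ‖x‖ ≤ ‖a‖ + ‖x - a‖ := by
        calc ‖x‖ = ‖a + (x - a)‖ := by ring_nf
          _ ≤ ‖a‖ + ‖x - a‖ := norm_add_le _ _
      linarith
    have hdeg : p.derivative.natDegree ≤ (p.natDegree - 2) + 1 :=
      (Polynomial.natDegree_derivative_le p).trans (by omega)
    rw [hderiv]
    calc ‖p.derivative.eval x - p.derivative.eval a‖
        ≤ coeffNormSum p.derivative * ((p.natDegree - 2 : ℕ) + 1) * M ^ (p.natDegree - 2) *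
            ‖x - a‖ := norm_eval_sub_eval_le p.derivative hM hxM ha hdeg
      _ ≤ L := by
          rw [hL]
          exact mul_le_mul_of_nonneg_left hx (by
            have := coeffNormSum_nonneg p.derivative; positivity)
  have hmvt := (convex_closedBall a ‖s‖).norm_image_sub_le_of_norm_deriv_le hdiff hbound
    (mem_closedBall_self (norm_nonneg s)) (show a + s ∈ closedBall a ‖s‖ by simp)
  have hfs : f (a + s) - f a = p.eval (a + s) - p.eval a - p.derivative.eval a * s := by
    simp only [hf]; ring
  rw [hfs, add_sub_cancel_left] at hmvt
  exact hmvt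

/-- **Pointwise bound for the perturbation, `‖ζ‖ ≤ R`.**  As `expExp_perturbation_bound`
(`g = (A(z) + u F̃(u)) e^{ζ - z}`, `lc(F) u^{e} = e^{z - ζ}`, `T > 0`) with
`‖g‖ ≤ (B_A max(1,‖z‖)^{deg A} + (B̃ + 1)(1/T + T^{deg F})) e^{R - Re z} + (B̃ + 1) e^{2R}/(|lc F| T)`.
[folklore] -/
theorem expExp_perturbation_bound_of_norm_le (A : Polynomial ℂ) {F : Polynomial ℂ} (hF : F ≠ 0)
    {T : ℝ} (hT : 0 < T) (z ζ u : ℂ) {R : ℝ} (hζ : ‖ζ‖ ≤ R)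
    (hcue : F.leadingCoeff * u ^ (F.natDegree + 1) = exp (z - ζ)) :
    ‖(A.eval z + u * F.eraseLead.eval u) * exp (ζ - z)‖ ≤
      ((∑ i ∈ Finset.range (A.natDegree + 1), ‖A.coeff i‖) * max 1 ‖z‖ ^ A.natDegree +
        ((∑ i ∈ Finset.range (F.eraseLead.natDegree + 1), ‖F.eraseLead.coeff i‖) + 1) *
          (1 / T + T ^ F.natDegree)) * Real.exp (R - z.re) +
      ((∑ i ∈ Finset.range (F.eraseLead.natDegree + 1), ‖F.eraseLead.coeff i‖) + 1) *
        Real.exp (2 * R) / (‖F.leadingCoeff‖ * T) := by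
  set e : ℕ := F.natDegree + 1 with he
  have hepos : 0 < e := by positivity
  set c : ℂ := F.leadingCoeff with hcdef
  have hc0 : c ≠ 0 := Polynomial.leadingCoeff_ne_zero.2 hF
  have hcpos : 0 < ‖c‖ := norm_pos_iff.2 hc0
  set Fe : Polynomial ℂ := F.eraseLead with hFe
  set BA : ℝ := ∑ i ∈ Finset.range (A.natDegree + 1), ‖A.coeff i‖ with hBA
  have hBA0 : 0 ≤ BA := Finset.sum_nonneg fun _ _ => norm_nonneg _
  set Be : ℝ := ∑ i ∈ Finset.range (Fe.natDegree + 1), ‖Fe.coeff i‖ with hBe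
  have hBe0 : 0 ≤ Be := Finset.sum_nonneg fun _ _ => norm_nonneg _
  have hue_norm : ‖u‖ ^ e = Real.exp (z.re - ζ.re) / ‖c‖ := by
    have h := congrArg norm hcue
    rw [norm_mul, norm_pow, Complex.norm_exp (z - ζ), Complex.sub_re] at h
    rw [eq_div_iff hcpos.ne', mul_comm]
    exact h
  have hζre : ζ.re ≤ R := (abs_le.1 ((Complex.abs_re_le_norm ζ).trans hζ)).2
  have hζre' : -R ≤ ζ.re := (abs_le.1 ((Complex.abs_re_le_norm ζ).trans hζ)).1
  have hexp : ‖exp (ζ - z)‖ ≤ Real.exp (R - z.re) := by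
    rw [Complex.norm_exp, Complex.sub_re]; exact Real.exp_le_exp.2 (by linarith)
  have hAz : ‖A.eval z‖ ≤ BA * max 1 ‖z‖ ^ A.natDegree :=
    Literature.ModelTheory.Zilber.norm_eval_le_sum_mul_pow A z
  have huFe : ‖u * Fe.eval u‖ ≤ (Be + 1) * ((1 + Real.exp (z.re - ζ.re) / ‖c‖) / T + T ^ (e - 1)) := by
    by_cases hFe0 : Fe = 0
    · rw [hFe0, Polynomial.eval_zero, mul_zero, norm_zero]; positivity
    · have hf1 : 1 ≤ F.natDegree := by
        by_contra h
        push Not at h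
        have h0 : F.natDegree = 0 := by omega
        apply hFe0
        rw [hFe, Polynomial.eq_C_of_natDegree_eq_zero h0, Polynomial.eraseLead_C]
      have hdegFe : 1 + Fe.natDegree ≤ e - 1 := by
        have := Polynomial.eraseLead_natDegree_le F
        rw [← hFe] at this; omega
      set t : ℝ := max 1 ‖u‖ with ht
      have ht1 : 1 ≤ t := le_max_left _ _
      have ht0 : 0 ≤ t := zero_le_one.trans ht1
      have h1 : ‖u * Fe.eval u‖ ≤ Be * t ^ (1 + Fe.natDegree) := by
        rw [norm_mul, pow_add, pow_one]
        calc ‖u‖ * ‖Fe.eval u‖ ≤ t * (Be * t ^ Fe.natDegree) :=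
              mul_le_mul (le_max_right _ _) (Literature.ModelTheory.Zilber.norm_eval_le_sum_mul_pow Fe u)
                (norm_nonneg _) ht0
          _ = Be * (t * t ^ Fe.natDegree) := by ring
      have h2 : t ^ (1 + Fe.natDegree) ≤ t ^ (e - 1) := pow_le_pow_right₀ ht1 hdegFe
      have h3 : t ^ (e - 1) ≤ t ^ e / T + T ^ (e - 1) := pow_pred_le_div_add ht0 hT hepos
      have h4 : t ^ e ≤ 1 + ‖u‖ ^ e := by
        rcases le_total 1 ‖u‖ with h | h
        · rw [ht, max_eq_right h]; linarith
        · rw [ht, max_eq_left h, one_pow]; linarith [pow_nonneg (norm_nonneg u) e]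
      rw [hue_norm] at h4
      calc ‖u * Fe.eval u‖ ≤ Be * t ^ (1 + Fe.natDegree) := h1
        _ ≤ Be * t ^ (e - 1) := mul_le_mul_of_nonneg_left h2 hBe0
        _ ≤ (Be + 1) * t ^ (e - 1) := mul_le_mul_of_nonneg_right (by linarith) (pow_nonneg ht0 _)
        _ ≤ (Be + 1) * (t ^ e / T + T ^ (e - 1)) := mul_le_mul_of_nonneg_left h3 (by positivity)
        _ ≤ (Be + 1) * ((1 + Real.exp (z.re - ζ.re) / ‖c‖) / T + T ^ (e - 1)) := by gcongr
  have he1 : e - 1 = F.natDegree := by rw [he]; omega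
  rw [he1] at huFe
  -- assemble
  have hXE : Real.exp (z.re - ζ.re) * Real.exp (R - z.re) = Real.exp (R - ζ.re) := by
    rw [← Real.exp_add]; ring_nf
  have hlast : (Be + 1) / (‖c‖ * T) * Real.exp (R - ζ.re) ≤
      (Be + 1) * Real.exp (2 * R) / (‖c‖ * T) := by
    rw [div_mul_eq_mul_div]
    gcongr
    linarith
  rw [norm_mul]
  calc ‖A.eval z + u * Fe.eval u‖ * ‖exp (ζ - z)‖
      ≤ (‖A.eval z‖ + ‖u * Fe.eval u‖) * Real.exp (R - z.re) :=
        mul_le_mul (norm_add_le _ _) hexp (norm_nonneg _) (by positivity)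
    _ ≤ (BA * max 1 ‖z‖ ^ A.natDegree +
          (Be + 1) * ((1 + Real.exp (z.re - ζ.re) / ‖c‖) / T + T ^ F.natDegree)) *
            Real.exp (R - z.re) := by
        gcongr
    _ = (BA * max 1 ‖z‖ ^ A.natDegree + (Be + 1) * (1 / T + T ^ F.natDegree)) * Real.exp (R - z.re) +
          (Be + 1) / (‖c‖ * T) * (Real.exp (z.re - ζ.re) * Real.exp (R - z.re)) := by ring
    _ ≤ _ := by rw [hXE]; gcongr

/-- `‖e^{h}(1 + g) - 1‖ ≤ 1/32` when `‖h‖, ‖g‖ ≤ 1/200` (`e^{h}(1+g) - 1 = (e^{h} - 1)(1 + g) + g`).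
[folklore] -/
theorem norm_exp_mul_one_add_sub_one_le {h g : ℂ} (hh : ‖h‖ ≤ 1 / 200) (hg : ‖g‖ ≤ 1 / 200) :
    ‖exp h * (1 + g) - 1‖ ≤ 1 / 32 := by
  have h1 : ‖exp h - 1‖ ≤ 2 * ‖h‖ := Complex.norm_exp_sub_one_le (by linarith)
  have hsplit : exp h * (1 + g) - 1 = (exp h - 1) * (1 + g) + g := by ring
  rw [hsplit]
  calc ‖(exp h - 1) * (1 + g) + g‖ ≤ ‖exp h - 1‖ * ‖1 + g‖ + ‖g‖ := by
        refine (norm_add_le _ _).trans ?_; rw [norm_mul]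
    _ ≤ (2 * ‖h‖) * (1 + ‖g‖) + ‖g‖ := by
        gcongr
        exact (norm_add_le _ _).trans (by rw [norm_one])
    _ ≤ 1 / 32 := by nlinarith [norm_nonneg h, norm_nonneg g]

end Summit.Schanuel.Schanuel.Theorems

end
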